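import Summits.HubbardSuperconductivity.HubbardSuperconductivity.Theorems.AnisotropyChordTransferFibre3RowCFactor
import Summits.HubbardSuperconductivity.HubbardSuperconductivity.Theorems.AnisotropyChordTransferFibre3StripTBand

/-!
# Route `AnisotropyChord` / H0 rotor rung, row C (KT-2b), PartN41-E §2 DROP-IN: the BANDED η-factorised sharp program `rowCEFT`
/ `rowCCellCheckFT` and its soundness ★★★ `RowC.offPoleTail_of_rowCCheckFT`

Theory-1 g23's second strip lever (`TBand`/`ChiNT`, needed at the small-ν end ν < 3.16e-4): in the η-factorised Chi of `…RowCFactor`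
the two `t·R̄/η²` slots are replaced by `min(t·R̄/η², tRbT/η²)`, `tRbT/η² = 2·TB(ν) + 2t(t + t‖s‖²)/(4π²η)`, `TB(ν) = 0.00794 + 0.00226ν`
(`Chi1TE`, ★ `rowCEFT`, ★ `rowCCellCheckFT`).  At the TRUE vector the `min` is its first argument: ★ `band_at` (`t(1−a) ≤ TB·η` from the
landed `RowC.tBand_holds`, the `t‖s‖²` terms cancel, `−2t²(1−a)²/4π² − 2ηt ≤ 0` dropped) + `eval_rowCEFT_of_band`, so the banded program
evaluates to the factorised one there and the soundness chain of `…RowCFactor` applies verbatim: `rowC_coreFT`, ★★★ `offPoleTail_of_rowCCheckFT`.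
The gain is purely in the interval evaluation over a cell, where `t·R̄` is otherwise read at `t = t₀`, `a = a₁`.
Prover seat `hubbard-h0-rotor-p1` g29 (route lead); helper for piece A = stmt-HubbardSuperconductivity-23918 of rung 19089
(`--supports`, helper class).  Nothing here proves superconductivity in the Hubbard model; one kernel program + soundness of ONE row
of ONE conditional reduction; the rotor TARGET as originally worded stays FALSE (g15 verdict).  Tree imports only; no sorry.
-/

set_option linter.dupNamespace false
set_option autoImplicit false

open Literature.Analysis.ValidatedNumerics

namespace Summit.HubbardSuperconductivity.HubbardSuperconductivity.Theorems.AnisotropyChord.Transfer.Fibre3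

namespace RowC

open L2.N1

variable (L : ℕ) [NeZero L]

/-! ## PartN41-E §2 on top of the factorised program: the manifold t-BAND in the `t·R̄` slots (`ChiNT`) -/

/-- the band constant `TB(ν) = 0.00794 + 0.00226ν` (`N41E.TBandConst`). -/
def TBcE : RExpr := .add (cst 0.00794) (.mul (cst 0.00226) yNu)
/-- the banded majorant of `t·R̄/η²`: `tRbT/η² = 2·TB(ν) + 2t(t + t‖s‖²)/(4π²η)`. -/
def TRT1E : RExpr := .add (.mul (cst 2) TBcE) (.mul (.mul (.mul (cst 2) yT) (.add yT ts2E)) (.inv (.mul fourPi2 etaE)))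
/-- ★ `Chi/η²` with BOTH `t·R̄/η²` slots replaced by `min(t·R̄/η², tRbT/η²)` (theory's `ChiNT`, η-normalised). -/
def Chi1TE (xshi : ℚ) : RExpr :=
  .add (.add (.mul (.mul (.mul (cst 4) yE1) tQ0E) (X1E xshi))
      (.mul (.mul yE1 (.min TR1E TRT1E)) (.add GamE (.mul (.mul (cst 2) (.sq fnnE)) (.sq MNE)))))
    (.mul (.mul (cst 2) yE1) (.sqrt (.mul (.mul (.mul (.mul (cst 4) tQ0E) (X1E xshi)) GamE) (.min TR1E TRT1E))))
/-- ★ THE BANDED η-FACTORISED SHARP ROW-C INEQUALITY (`rowCEF` with `Chi1TE`). -/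
def rowCEFT (xshi bC : ℚ) : RExpr :=
  .sub (.mul (cst 9) (.sq (.add (.sqrt (Chi1TE xshi)) (.sqrt Nhi1E))))
    (.mul (.mul (.mul (.mul (cst 48) yPi2) (cst bC)) (.sub (.mul (cst 2) yE1) tauE))
      (.sub (cst 3) (.mul (.mul (.mul (cst (3/2)) yQ) (.inv yP)) (.inv yNu))))
/-- ★ THE BANDED η-FACTORISED SHARP CELL CHECK. -/
def rowCCellCheckFT (c : L2.NamedCell) (a1 a2 xshi bC : ℚ) (pi : ℕ × ℕ) : Bool :=
  match cellFinalBoxC c a1 a2 2 pi with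
  | none => false
  | some F =>
    decide (F.length = 10) &&
    rexprLeOn (rowCEFT xshi bC) 0 (rowCBox c F) pi &&
    rexprLeOn (.neg yP) (-1) (rowCBox c F) pi &&
    rexprLeOn (.neg tauE) 0 (rowCBox c F) pi &&
    rexprLeOn (.sub tauE (.mul (cst 2) yE1)) 0 (rowCBox c F) pi

/-- under the band inequality at a vector, the banded program evaluates to the factorised one. [folklore] -/
theorem eval_rowCEFT_of_band (y : ℕ → ℝ) (hb : TR1E.eval y ≤ TRT1E.eval y) (xshi bC : ℚ) :
    (rowCEFT xshi bC).eval y = (rowCEF xshi bC).eval y := by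
  have hmin : (RExpr.min TR1E TRT1E).eval y = TR1E.eval y := by
    simp only [RExpr.eval]; exact min_eq_left hb
  simp only [rowCEFT, rowCEF, Chi1TE, Chi1E, RExpr.eval] at hmin ⊢
  rw [hmin]

/-- ★ THE BAND AT THE TRUE VECTOR: if `y₀ = t ≥ 0`, `y₁ = π²`, `y₂ = ν > 0`, `y₃ = a` and `t(1 − a) ≤ TB(ν)·π²ν` (`tBand_holds`),
then `TR1E ≤ TRT1E` at `y` (the `t‖s‖²` terms cancel; `−2t²(1−a)²/4π² − 2ηt ≤ 0` is dropped). [folklore] -/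
theorem band_at (y : ℕ → ℝ) (hπ : y 1 = Real.pi ^ 2) (ht : 0 ≤ y 0) (hν : 0 < y 2)
    (hTB : y 0 * (1 - y 3) ≤ (0.00794 + 0.00226 * y 2) * (Real.pi ^ 2 * y 2)) :
    TR1E.eval y ≤ TRT1E.eval y := by
  have hπ0 := Real.pi_pos
  have hE : 0 < Real.pi ^ 2 * y 2 := by positivity
  simp only [TR1E, TRT1E, TBcE, tau1E, etaE, fourPi2, yPi2, yNu, yA, yT, cst, RExpr.eval, hπ]
  push_cast
  rw [← sub_nonneg]
  have key : (2 * (794e-5 + 226e-5 * y 2) + 2 * y 0 * (y 0 + ts2E.eval y) * (4 * Real.pi ^ 2 * (Real.pi ^ 2 * y 2))⁻¹)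
      - y 0 * (Real.pi ^ 2 * y 2)⁻¹ * (2 * (1 - y 3) + 2 * (y 0 + ts2E.eval y - y 0 * (1 - y 3) ^ 2) * (4 * Real.pi ^ 2)⁻¹
          - 2 * (Real.pi ^ 2 * y 2))
      = (2 * ((794e-5 + 226e-5 * y 2) * (Real.pi ^ 2 * y 2)) - 2 * (y 0 * (1 - y 3))
          + 2 * y 0 ^ 2 * (1 - y 3) ^ 2 * (4 * Real.pi ^ 2)⁻¹ + 2 * y 0 * (Real.pi ^ 2 * y 2)) * (Real.pi ^ 2 * y 2)⁻¹ := by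
    field_simp
    ring
  rw [key]
  apply mul_nonneg _ (inv_nonneg.mpr hE.le)
  have h1 : 0 ≤ 2 * y 0 ^ 2 * (1 - y 3) ^ 2 * (4 * Real.pi ^ 2)⁻¹ := by positivity
  have h2 : 0 ≤ 2 * y 0 * (Real.pi ^ 2 * y 2) := by positivity
  nlinarith

/-! ## Soundness -/

/-- ★ CORE: a passing row-C check gives, at the ground profile, `P̂ > 0` and the evaluated row inequality
`9(√ChiN + √NhiN)² ≤ 48π⁴·bC·π²ν·(2ê₁ − τ)·τ`, `τ = 3ν − (3/2)Q̂₁/P̂`. [folklore] -/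
theorem rowC_coreFT (c : L2.NamedCell) (a1 a2 xshi bC : ℚ) (pi : ℕ × ℕ)
    (hchk : rowCCellCheckFT c a1 a2 xshi bC pi = true) (hc : c.check = true) (hL : 128 ≤ L)
    {Δ lam2 : ℝ} {f : Tor L → ℝ} (hΔ0 : 0 ≤ Δ) (hΔ1 : Δ < 1) (hf : IsGroundTwoMagnon L Δ lam2 f)
    (hν1 : (c.n1 : ℝ) / c.νd ≤ lam2 / (2 * Real.pi / L) ^ 2) (hν2 : lam2 / (2 * Real.pi / L) ^ 2 ≤ (c.n2 : ℝ) / c.νd)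
    (ha1 : ((a1 : ℚ) : ℝ) ≤ Δ * f (K1 L)) (ha2 : Δ * f (K1 L) ≤ ((a2 : ℚ) : ℝ)) :
    let t : ℝ := (2 * Real.pi / L) ^ 2
    let vP : ℝ := t ^ 3 * ∑ k : Tor L, F2 L f k ^ 3
    let vQ : ℝ := t ^ 2 * ∑ k : Tor L, nK L f k * F2 L f k
    0 < vP ∧ t ^ 2 * S2n L lam2 ≤ ((c.bS2.2 : ℚ) : ℝ) ∧ t ^ 2 * T10n L lam2 ≤ ((c.bT10.2 : ℚ) : ℝ) ∧
    9 * (Real.sqrt (ChiN t (lam2 / t) (Δ * f (K1 L)) (eps1 L / t) (t ^ 2 * S2n L lam2) xshi)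
        + Real.sqrt (NhiN t (lam2 / t) (Δ * f (K1 L)) (t ^ 2 * S2n L lam2) (aKer L lam2 (ex L + ey L))
            (aKer L lam2 (ex L + ex L)) (N41E.ZwSN t (lam2 / t) (Δ * f (K1 L))))) ^ 2
      - 48 * (Real.pi ^ 2) ^ 2 * bC * (Real.pi ^ 2 * (lam2 / t)) * (2 * (eps1 L / t) - (3 * (lam2 / t) - 3 / 2 * vQ * vP⁻¹))
          * (3 * (lam2 / t) - 3 / 2 * vQ * vP⁻¹) ≤ 0 := by
  classical
  intro t vP vQ
  set X := xTrue L Δ lam2 f (Δ * f (K1 L)) with hXdef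
  have hLpos : (0 : ℝ) < L := by exact_mod_cast (show 0 < L by omega)
  have hπ := Real.pi_pos
  have ht0 : 0 < t := by positivity
  -- regime facts (as in `trialGap_of_cellCheck`)
  have hlam : 0 < lam2 := lam2_pos L (by omega) hΔ1 hf.1
  have h2 : 2 * lam2 < eps1 L := two_lam2_lt_eps1 L (by omega) hΔ0 hf
  obtain ⟨ha0, haV, _, _⟩ := ManifoldA.manifold_band L hL hΔ0 hΔ1 hf
  have hνc := ManifoldA.nu_ceiling L hL hΔ0 hf
  have hν4 : lam2 / (2 * Real.pi / L) ^ 2 < 4 / Real.pi ^ 2 := by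
    rw [div_lt_iff₀ ht0]
    have hπ2 : Real.pi ^ 2 < 10 := by nlinarith [Real.pi_lt_d2, Real.pi_pos]
    have : (0.031 : ℝ) ≤ 4 / Real.pi ^ 2 := by rw [le_div_iff₀ (by positivity)]; nlinarith
    nlinarith
  have hV1 : (1 : ℝ) / (L : ℝ) ^ 2 = t * (4 * Real.pi ^ 2)⁻¹ := by
    show (1 : ℝ) / (L : ℝ) ^ 2 = (2 * Real.pi / L) ^ 2 * (4 * Real.pi ^ 2)⁻¹
    field_simp; ring
  have hu' : 0 < 1 - Δ * f (K1 L) + Δ * f (K1 L) * ((2 * Real.pi / L) ^ 2 * (4 * Real.pi ^ 2)⁻¹) := by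
    have : (2 * Real.pi / (L : ℝ)) ^ 2 * (4 * Real.pi ^ 2)⁻¹ = 1 / (L : ℝ) ^ 2 := hV1.symm
    rw [this]; nlinarith
  obtain ⟨_, _, _, _, d5, _, _⟩ := ManifoldA.manifold_dictionary L (by omega) hΔ0 hΔ1 hf
  have hu : 0 < cS L Δ lam2 f * Gzero L lam2 := by
    rw [← Gres_zero_zero_eq_Gzero, d5]
    have : Δ * f (K1 L) / (L : ℝ) ^ 2 = Δ * f (K1 L) * ((2 * Real.pi / L) ^ 2 * (4 * Real.pi ^ 2)⁻¹) := by
      rw [← hV1]; ring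
    rw [this]; exact hu'
  -- the interval layer of p2
  have hPM : PMem (c.box a1 a2) X := pmem_xTrue c hc a1 a2 L hL Δ lam2 f _ hν1 hν2 ha1 ha2
  have hsp := xTrue_specs_ground L Δ lam2 f (by omega) hΔ0 hΔ1 hf hlam h2 hν4 ha0 hu'
  set vB : ℝ := ((2 * Real.pi / L) ^ 2) ^ 3 * ∑ k : Tor L, F2 L f k ^ 2 * F2 L f (k + K1 L) with hvB
  set vA : ℝ := ((2 * Real.pi / L) ^ 2) ^ 2 * ∑ k : Tor L, F2 L f k ^ 2 * cosx L k with hvA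
  set vJ : ℝ := ((2 * Real.pi / L) ^ 2) ^ 2 * ∑ k : Tor L, bcJ L f k with hvJ
  have oB := bHat_mem L Δ lam2 f (by omega) hΔ0 hΔ1 hf hlam h2 hu
  have oP := pHat_mem L Δ lam2 f (by omega) hΔ0 hΔ1 hf hlam h2 hu
  have oA := aHat_mem L Δ lam2 f (by omega) hΔ0 hΔ1 hf hlam h2 hu
  have oQ := q1Hat_mem L Δ lam2 f (by omega) hΔ0 hΔ1 hf hlam h2 hu
  have oJ := j1Hat_mem L Δ lam2 f (by omega) hΔ0 hΔ1 hf hlam h2 hu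
  have hob : ∀ j (hj : j < (objSpecsC 2).length) (hj' : j < [vB, vP, vA, vQ, vJ].length),
      ((objSpecsC 2)[j].1).eval X ≤ [vB, vP, vA, vQ, vJ][j] ∧ [vB, vP, vA, vQ, vJ][j] ≤ ((objSpecsC 2)[j].2).eval X := by
    intro j hj hj'
    have hj5 : j < 5 := by simpa [objSpecsC] using hj
    interval_cases j
    · simpa [objSpecsC] using oB
    · simpa [objSpecsC] using oP
    · simpa [objSpecsC] using oA
    · simpa [objSpecsC] using oQ
    · simpa [objSpecsC] using oJ
  -- unpack the row-C check
  have hlen0 : (c.box a1 a2).length = 16 := by simp [L2.NamedCell.box]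
  have hv := specsVarsOkC_two
  simp only [specsVarsOkC, Bool.and_eq_true] at hv
  obtain ⟨hv1, hv2⟩ := hv
  have hS : SpecsHold X (c.box a1 a2).length (specs 2) := by
    rw [hlen0]; exact specsHold_of X (specs 2) 16 hv1 hsp
  unfold rowCCellCheckFT cellFinalBoxC cellBox at hchk
  split at hchk
  · exact absurd hchk (by simp)
  · rename_i F hF
    split at hF
    · exact absurd hF (by simp)
    · rename_i B hB
      split at hF
      · exact absurd hF (by simp)
      · rename_i objs hobjs
        simp only [Option.some.injEq] at hF
        subst hF
        obtain ⟨hPB, hlenB⟩ := extendBox_sound pi.1 pi.2 X (specs 2) _ B hB hPM hS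
        have hO : ObjsHold X B.length (objSpecsC 2) [vB, vP, vA, vQ, vJ] := by
          rw [hlenB, hlen0]
          exact objsHold_of X _ (objSpecsC 2) [vB, vP, vA, vQ, vJ] (by simp [objSpecsC]) hv2 hob
        have hbr := encloseObjs_sound pi.1 pi.2 hPB (objSpecsC 2) [vB, vP, vA, vQ, vJ] objs hobjs hO
        have hmem := finalBox_mem hPB (by
          rw [hlenB, hlen0]
          simp only [specs, List.length_append, List.length_cons, List.length_nil, List.length_map]
          omega) hbr
        simp only [Bool.and_eq_true, decide_eq_true_eq] at hchk
        obtain ⟨⟨⟨⟨hFlen, hR⟩, hP⟩, _⟩, _⟩ := hchk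
        obtain ⟨y0, y1, y2, y3, y4, y5, y6, y7, y8, y9⟩ := finalVec_vals X vB vP vA vQ vJ
        -- coordinates of `X`
        have hX0 : X 0 = t := xTrue_zero L Δ lam2 f _
        have hX1 : X 1 = Real.pi ^ 2 := by rw [hXdef, xTrue_lt16 L Δ lam2 f _ (by norm_num)]; rfl
        have hX2 : X 2 = lam2 / t := by rw [hXdef, xTrue_lt16 L Δ lam2 f _ (by norm_num)]; rfl
        have hX3 : X 3 = Δ * f (K1 L) := by rw [hXdef, xTrue_lt16 L Δ lam2 f _ (by norm_num)]; rfl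
        have hX4 : X 4 = t ^ 2 * S2n L lam2 := by
          rw [hXdef, xTrue_lt16 L Δ lam2 f _ (by norm_num)]
          show (2 * Real.pi / L) ^ (2 * 2) * S2n L lam2 = _
          ring
        have hX7 : X 7 = t ^ 2 * T10n L lam2 := by
          rw [hXdef, xTrue_lt16 L Δ lam2 f _ (by norm_num)]
          show (2 * Real.pi / L) ^ (2 * 2) * T10n L lam2 = _
          ring
        have hX16 : X 16 = eps1 L / t := by rw [hXdef, xTrue_16]; rfl
        -- the brackets of `x₄`, `x₇` from the column box
        have hB4 := hPM 4 (by rw [hlen0]; norm_num)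
        have hB7 := hPM 7 (by rw [hlen0]; norm_num)
        have e4 : (c.box a1 a2).ivl 4 = c.bS2 := by simp [L2.NamedCell.box, Box.ivl]
        have e7 : (c.box a1 a2).ivl 7 = c.bT10 := by simp [L2.NamedCell.box, Box.ivl]
        rw [e4, hX4] at hB4
        rw [e7, hX7] at hB7
        -- the window values and the extended vector
        obtain ⟨h11, h20⟩ := window_k11_k20 L hL hΔ0 hΔ1 hf
        set y' := extVec (finalVec X [vB, vP, vA, vQ, vJ]) (t ^ 2 * S2n L lam2) (aKer L lam2 (ex L + ey L))
          (aKer L lam2 (ex L + ex L)) with hy'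
        have hmem' : (rowCBox c (finalBox B objs)).mem y' := extVec_mem c hFlen hmem hB4 h11 h20
        have eF := rexprLeOn_sound hR _ hmem'
        -- the factorised inequality implies the sharp one (multiply by `η² ≥ 0`)
        have g1' : y' 1 = Real.pi ^ 2 := by simp [hy', extVec, y1, hX1]
        have g2' : y' 2 = lam2 / t := by simp [hy', extVec, y2, hX2]
        have hν' : 0 < y' 2 := by rw [g2']; positivity
        -- the band at the true vector (`tBand_holds`) makes the banded program equal to the factorised one
        have g3' : y' 3 = Δ * f (K1 L) := by simp [hy', extVec, y3, hX3]
        have g0' : y' 0 = t := by simp [hy', extVec, y0, hX0]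
        obtain ⟨_, _, _, _, _, _, d7'⟩ := ManifoldA.manifold_dictionary L (by omega) hΔ0 hΔ1 hf
        have hTB0 := tBand_holds L hL Δ lam2 f hΔ0 hΔ1 hf
        unfold N41E.TBandConst at hTB0
        rw [d7'] at hTB0
        have hTB : y' 0 * (1 - y' 3) ≤ (0.00794 + 0.00226 * y' 2) * (Real.pi ^ 2 * y' 2) := by
          rw [g0', g3', g2']; exact hTB0
        have hband := band_at y' g1' (by rw [g0']; exact ht0.le) hν' hTB
        have eF' : (rowCEF xshi bC).eval y' ≤ 0 := by
          rw [← eval_rowCEFT_of_band y' hband xshi bC]; simpa using eF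
        have eR : (rowCSE xshi bC).eval y' ≤ ((0 : ℚ) : ℝ) := by
          rw [eval_rowCSE_eq_factor y' g1' hν' xshi bC]
          push_cast
          exact mul_nonpos_of_nonneg_of_nonpos (sq_nonneg _) eF'
        have eP1 := rexprLeOn_sound hP _ hmem'
        -- coordinates of `y'`
        have g0 : y' 0 = t := by simp [hy', extVec, y0, hX0]
        have g1 : y' 1 = Real.pi ^ 2 := by simp [hy', extVec, y1, hX1]
        have g2 : y' 2 = lam2 / t := by simp [hy', extVec, y2, hX2]
        have g3 : y' 3 = Δ * f (K1 L) := by simp [hy', extVec, y3, hX3]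
        have g4 : y' 4 = eps1 L / t := by simp [hy', extVec, y4, hX16]
        have g6 : y' 6 = vP := by simp [hy', extVec, y6]
        have g8 : y' 8 = vQ := by simp [hy', extVec, y8]
        have g10 : y' 10 = t ^ 2 * S2n L lam2 := by simp [hy', extVec]
        have g11 : y' 11 = aKer L lam2 (ex L + ey L) := by simp [hy', extVec]
        have g12 : y' 12 = aKer L lam2 (ex L + ex L) := by simp [hy', extVec]
        rw [eval_rowCSE y' g1 xshi bC, g0, g2, g3, g4, g6, g8, g10, g11, g12] at eR
        simp only [yP, RExpr.eval] at eP1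
        rw [g6] at eP1
        have e0 : (((0 : ℚ)) : ℝ) = 0 := by push_cast; ring
        have e1' : (((-1 : ℚ)) : ℝ) = -1 := by push_cast; ring
        rw [e0] at eR
        rw [e1'] at eP1
        exact ⟨by linarith, hB4.2, hB7.2, eR⟩

/-- ★★★ **A PASSING BANDED η-FACTORISED SHARP ROW-C CELL CHECK GIVES THE (KT-2b″) BOUND FOR EVERY `L ≥ 128` ON THE CELL** (window-shell
cancellation and manifold t-band built in; no extra hypothesis). -/
theorem offPoleTail_of_rowCCheckFT (c : L2.NamedCell) (a1 a2 xshi bC : ℚ) (pi : ℕ × ℕ) (Dxs : ℕ)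
    (hchk : rowCCellCheckFT c a1 a2 xshi bC pi = true) (hc : c.check = true)
    (hxs : xsCellCheck 128 c.n1 c.n2 c.νd c.Tn c.Td Dxs c.bS2.2 c.bT10.2 xshi = true)
    (hL : 128 ≤ L)
    {Δ lam2 : ℝ} {f : Tor L → ℝ} (hΔ0 : 0 ≤ Δ) (hΔ1 : Δ < 1) (hf : IsGroundTwoMagnon L Δ lam2 f)
    (hν1 : (c.n1 : ℝ) / c.νd ≤ lam2 / (2 * Real.pi / L) ^ 2) (hν2 : lam2 / (2 * Real.pi / L) ^ 2 ≤ (c.n2 : ℝ) / c.νd)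
    (ha1 : ((a1 : ℚ) : ℝ) ≤ Δ * f (K1 L)) (ha2 : Δ * f (K1 L) ≤ ((a2 : ℚ) : ℝ)) :
    (ip L (resid L Δ f) (resid L Δ f)).re - polePart L Δ f - lowNormPart L Δ f
      ≤ (bC : ℝ) * etaEff L lam2 * (2 * eps1 L - Tplus L Δ f) * Uunit L Δ f := by
  have hLpos : (0 : ℝ) < L := by exact_mod_cast (show 0 < L by omega)
  have hπ := Real.pi_pos
  have hL2 : 2 ≤ L := by omega
  set t : ℝ := (2 * Real.pi / L) ^ 2 with ht
  have ht0 : 0 < t := by positivity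
  obtain ⟨hvP0, hx4, hx7, eR⟩ := rowC_coreFT L c a1 a2 xshi bC pi hchk hc hL hΔ0 hΔ1 hf hν1 hν2 ha1 ha2
  have hT := Tplus_eq_tau L hL2 hf hvP0
  rw [← ht] at hvP0 hx4 hx7 eR hT
  set vP : ℝ := t ^ 3 * ∑ k : Tor L, F2 L f k ^ 3 with hvP
  set vQ : ℝ := t ^ 2 * ∑ k : Tor L, nK L f k * F2 L f k with hvQ
  -- the X-sum certificate
  have hlamθ : lam2 = lam2 / t * (2 * Real.pi / L) ^ 2 := by rw [ht]; field_simp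
  have hXS : XSn L lam2 ≤ ((xshi : ℚ) : ℝ) := by
    have h := xs_cell_sound 128 c.n1 c.n2 c.νd c.Tn c.Td Dxs c.bS2.2 c.bT10.2 xshi hxs L hL (lam2 / t)
      (by rw [ht]; exact hν1) (by rw [ht]; exact hν2)
      (by rw [← hlamθ, ← ht]; exact hx4) (by rw [← hlamθ, ← ht]; exact hx7)
    rw [← hlamθ] at h; exact h
  -- the two closed-form majorants at the true profile
  have hChi := cs2_le_ChiN L hL hΔ0 hΔ1 hf ((xshi : ℚ) : ℝ) hXS
  have hNhi := nC0p_le_NhiN L hL hΔ0 hΔ1 hf _ (shellWinSharpN_holds L hL Δ lam2 f hΔ0 hΔ1 hf)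
  rw [← ht] at hChi hNhi
  -- the RHS identity
  obtain ⟨_, _, _, _, _, _, d7⟩ := ManifoldA.manifold_dictionary L (by omega) hΔ0 hΔ1 hf
  have hVθ : ((L : ℝ) ^ 2) = 4 * Real.pi ^ 2 / t := by rw [ht]; field_simp; ring
  have hRHS : (bC : ℝ) * etaEff L lam2 * (2 * eps1 L - Tplus L Δ f) * Uunit L Δ f
      = 48 * (Real.pi ^ 2) ^ 2 * bC * (Real.pi ^ 2 * (lam2 / t))
          * (2 * (eps1 L / t) - (3 * (lam2 / t) - 3 / 2 * vQ * vP⁻¹)) * (3 * (lam2 / t) - 3 / 2 * vQ * vP⁻¹) := by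
    unfold Uunit
    rw [d7, ← ht, hT, hVθ]
    field_simp
    ring
  -- the LHS chain
  have hmirror : ∀ r : Tor L, f (-r.1, r.2) = f r := ground_mirror L hL2 hf
  have hpieces := offPoleTailFromPieces_holds L hL2 Δ lam2 f hf hmirror
  have hP0 := polePartNonneg_holds L Δ f
  have hN0 := lowNormPartNonneg_holds L Δ f
  have hsq : (3 * Real.sqrt (cs2 L f) + 3 * Real.sqrt (nC0p L Δ f)) ^ 2
      ≤ 9 * (Real.sqrt (ChiN t (lam2 / t) (Δ * f (K1 L)) (eps1 L / t) (t ^ 2 * S2n L lam2) xshi)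
        + Real.sqrt (NhiN t (lam2 / t) (Δ * f (K1 L)) (t ^ 2 * S2n L lam2)
            (aKer L lam2 (ex L + ey L)) (aKer L lam2 (ex L + ex L)) (N41E.ZwSN t (lam2 / t) (Δ * f (K1 L))))) ^ 2 := by
    have s1 := Real.sqrt_le_sqrt hChi
    have s2 := Real.sqrt_le_sqrt hNhi
    have e : (3 * Real.sqrt (cs2 L f) + 3 * Real.sqrt (nC0p L Δ f)) ^ 2
        = 9 * (Real.sqrt (cs2 L f) + Real.sqrt (nC0p L Δ f)) ^ 2 := by ring
    rw [e]
    apply mul_le_mul_of_nonneg_left _ (by norm_num)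
    apply pow_le_pow_left₀ (by positivity)
    linarith
  rw [hRHS]
  linarith [hpieces, hP0, hN0, hsq, eR]

end RowC

end Summit.HubbardSuperconductivity.HubbardSuperconductivity.Theorems.AnisotropyChord.Transfer.Fibre3
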